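import Summits.BirchSwinnertonDyer.Rank1Residual.F1Sign2.OddBranchFunctionalEquationAtTwo
import Summits.BirchSwinnertonDyer.Rank1Residual.F1Sign2.SharpValueFourDvdAtChi8
import Summits.BirchSwinnertonDyer.Rank1Residual.Supersingular.PollackConstantTerm
import HarnessLib

/-!
# `OddBranchValuesAtTwo` — Part 5 of the odd-branch series at `2` (g3): §8 the VALUES of the odd pair at the two `ι`-fixed
points — `L♯₋(0) = 0` (forced zero at `χ₋₄`, `a₂ = 0`), `L♭₋(0) = −2[1/4]⁻_f`,
`L♯₋(−2) = −2([1/8]⁻_f − [5/8]⁻_f)` (any `a₂`), `θ⁻₁(−2) = 2([1/8]⁻ − [5/8]⁻)`. See Part 1 for the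
overview; Part 6 draws the consequences of the functional equation for these values.

TURNKEY filing by the typer seat `bsd-f1-sign2-ty` (D-ty-6, part 5/6 of -an g3's kernel file `OddFE.lean`
200de6ab6bb130d9, pre-split by the planner): `HOME/MEMO-an-data/g3/split/OddBranchValuesAtTwo.lean` sha16 dd44a3010cbaa7df
(joint farm checks `JointA_parts1to4` 000c30d5de228c06 / `JointB_parts1to6` cbbe6a2064807d53: rc 0, 0 warnings, 0 sorries),
re-filed VERBATIM. PROOF-ONLY module (theorems; no definition, no named fact). REF2-PLACEMENT-v8 §0: the odd-branch
functional equation at 2 is IN PRINT (Sprung, ANT 11 (2017), Cor. 4.14 at (p, i) = (2, 1); Sprung arXiv:1211.1352 Thm 3.16 /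
Cor 3.17) — formalised here, not new; beyond-print theorem: no for the FE itself; the value corollaries at `T = 0` / `T = −2` are the `T¹`/`T²`-coefficient
readings of the FE = IN-PRINT-ASSEMBLY per REF2-PLACEMENT-v9 §2–§3 (Dion–Sprung 2019, Thm. 5.1 and Thm. 4.1).
[cite: DionSprung2019, Thm. 5.1 and Thm. 4.1] [cite: Sprung2017, Cor. 4.14]
-/

set_option autoImplicit false

noncomputable section

open scoped MatrixGroups ModularForm

open CongruenceSubgroup PowerSeries Filter Topology
  Literature.NumberTheory.EllipticCurves Literature.NumberTheory.EllipticCurves.ModularForms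
  Literature.NumberTheory.EllipticCurves.Sprung2017 Literature.Barriers.BirchSwinnertonDyer

namespace Summit.BirchSwinnertonDyer.Rank1Residual.F1Sign2

/-! ## §8. Values of the odd pair at `T = 0` and `T = −2`

`u₀ = 0`, `v₀ = 1`, `u₁ = 1`, `v₁ = 0` (`sharpPoly_zero/one`, `flatPoly_zero/one`), `ω₀ = T`,
`ω₁(−2) = 0`; `θ⁻₀ = 2[1/4]⁻`, `θ⁻₁ = 2[1/8]⁻ + 2[5/8]⁻(1+T)`. Hence for ANY odd pair:
`L♭₋(0) = −θ⁻₀(0) = −2[1/4]⁻`, `L♯₋(0) = −θ⁻₁(0) = −2([1/8]⁻ + [5/8]⁻) = −2a₂[1/4]⁻` (`= 0` when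
`a₂ = 0`, g2), `L♯₋(−2) = −θ⁻₁(−2) = −2([1/8]⁻ − [5/8]⁻)`. -/

section Values

open Summit.BirchSwinnertonDyer.Rank1Residual.Supersingular

variable {N : ℕ} [NeZero N] (f : CuspForm (Gamma0 N) 2)

/-- `[1/2]⁻_f = 0`: `[1/2]⁻ = [−1/2 + 1]⁻ = [−1/2]⁻ = −[1/2]⁻`.
[cite: MazurTateTeitelbaum1986Invent, §I.8] -/
theorem ratMinusSymbol_one_half : ratMinusSymbol f (1 / 2) = 0 := by
  have h : ratMinusSymbol f (1 / 2) = -ratMinusSymbol f (1 / 2) := by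
    conv_lhs => rw [show (1 / 2 : ℚ) = -(1 / 2) + ((1 : ℤ) : ℚ) by norm_num]
    rw [ratMinusSymbol_add_intCast, ratMinusSymbol_neg]
  linarith

/-- **`θ⁻₁(0) = 2([1/8]⁻_f + [5/8]⁻_f)`**. [cite: MazurTateTeitelbaum1986Invent, §I.13 (p = 2)] -/
theorem eval_zero_mazurTateElementOdd_two_one :
    (mazurTateElementOdd f 2 1).eval 0 =
      2 * (ratMinusSymbol f ((1 : ℚ) / 8) + ratMinusSymbol f ((5 : ℚ) / 8)) := by
  rw [mazurTateElementOdd_two_eq, Polynomial.eval_finsetSum]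
  have h8 : (cyclotomicGenerator 2 : ZMod (2 ^ (1 + 2))) = 5 := by
    rw [cyclotomicGenerator_two]; rfl
  rw [show (Finset.univ : Finset (ZMod (2 ^ 1))) = {0, 1} from rfl, Finset.sum_pair (by decide)]
  simp only [Polynomial.eval_mul, Polynomial.eval_C, Polynomial.eval_pow, Polynomial.eval_add,
    Polynomial.eval_X, Polynomial.eval_one, h8]
  have h0 : ((0 : ZMod (2 ^ 1))).val = 0 := rfl
  have h1 : ((1 : ZMod (2 ^ 1))).val = 1 := rfl
  rw [h0, h1]
  have h5 : (((5 : ZMod (2 ^ (1 + 2))) ^ 1).val : ℚ) = 5 := by decide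
  have h50 : (((5 : ZMod (2 ^ (1 + 2))) ^ 0).val : ℚ) = 1 := by decide
  rw [h5, h50]
  norm_num
  ring

/-- **`θ⁻₁(−2) = 2([1/8]⁻_f − [5/8]⁻_f)`** (the level-`8` element of the `χ₋₄`-branch at the wild
character `ψ(5) = −1`, i.e. at `χ₋₄ψ = χ₋₈`: the `E^{(−2)}`-value).
[cite: MazurTateTeitelbaum1986Invent, §I.13 (p = 2)] -/
theorem eval_neg_two_mazurTateElementOdd_two_one :
    (mazurTateElementOdd f 2 1).eval (-2) =
      2 * (ratMinusSymbol f ((1 : ℚ) / 8) - ratMinusSymbol f ((5 : ℚ) / 8)) := by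
  rw [mazurTateElementOdd_two_eq, Polynomial.eval_finsetSum]
  have h8 : (cyclotomicGenerator 2 : ZMod (2 ^ (1 + 2))) = 5 := by
    rw [cyclotomicGenerator_two]; rfl
  rw [show (Finset.univ : Finset (ZMod (2 ^ 1))) = {0, 1} from rfl, Finset.sum_pair (by decide)]
  simp only [Polynomial.eval_mul, Polynomial.eval_C, Polynomial.eval_pow, Polynomial.eval_add,
    Polynomial.eval_X, Polynomial.eval_one, h8]
  have h0 : ((0 : ZMod (2 ^ 1))).val = 0 := rfl
  have h1 : ((1 : ZMod (2 ^ 1))).val = 1 := rfl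
  rw [h0, h1]
  have h5 : (((5 : ZMod (2 ^ (1 + 2))) ^ 1).val : ℚ) = 5 := by decide
  have h50 : (((5 : ZMod (2 ^ (1 + 2))) ^ 0).val : ℚ) = 1 := by decide
  rw [h5, h50]
  norm_num
  ring

/-- **`θ⁻₁(0) = a₂ · θ⁻₀(0)` at `p = 2`** for a rational newform of odd level: the Manin–Hecke
relation `a₂[1/4]⁻ = [1/8]⁻ + [5/8]⁻ + [1/2]⁻` with `[1/2]⁻ = 0` and `θ⁻₀ = 2[1/4]⁻`.
[cite: MazurTateTeitelbaum1986Invent, §I.4 (4.2), §I.8, §I.13] -/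
theorem eval_zero_mazurTateElementOdd_two_one_eq_mul (hf : IsNewform0 f) (hQ : coeffField f = ⊥)
    (h2N : ¬ 2 ∣ N) {ap : ℤ} (hap : cuspCoeff f 2 = ap) :
    (mazurTateElementOdd f 2 1).eval 0 = ap * (mazurTateElementOdd f 2 0).eval 0 := by
  have hH := intCast_mul_ratMinusSymbol 2 hf Nat.prime_two h2N hap (ratCast_ratMinusSymbol f hf hQ)
    ((1 : ℚ) / 4)
  rw [Fin.sum_univ_two] at hH
  simp only [Fin.val_zero, Fin.val_one, Nat.cast_zero, Nat.cast_one, Nat.cast_ofNat] at hH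
  rw [show ((1 : ℚ) / 4 + 0) / 2 = 1 / 8 by norm_num, show ((1 : ℚ) / 4 + 1) / 2 = 5 / 8 by norm_num,
    show (2 : ℚ) * (1 / 4) = 1 / 2 by norm_num, ratMinusSymbol_one_half, add_zero] at hH
  rw [eval_zero_mazurTateElementOdd_two_one, mazurTateElementOdd_two_zero, Polynomial.eval_C, ← hH]
  ring

/-- **`a₂ = 0 ⇒ θ⁻₁(0) = 0`** (AN-6, g2). [cite: MazurTateTeitelbaum1986Invent, §I.4 (4.2), §I.13] -/
theorem eval_zero_mazurTateElementOdd_two_one_eq_zero (hf : IsNewform0 f) (hQ : coeffField f = ⊥)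
    (h2N : ¬ 2 ∣ N) (hap : cuspCoeff f 2 = ((0 : ℤ) : ℂ)) :
    (mazurTateElementOdd f 2 1).eval 0 = 0 := by
  rw [eval_zero_mazurTateElementOdd_two_one_eq_mul f hf hQ h2N hap]
  simp

/-- **`a₂ = 0 ⇒ L♯₋(0) = 0` for EVERY odd Sprung pair** (AN-6, g2): the level-1 clause
`θ⁻₁ ≡ −L♯₋ (mod ω₁)` at `T = 0`. [cite: Sprung2017, Cor. 4.4 (shape)]
[cite: MazurTateTeitelbaum1986Invent, §I.4 (4.2), §I.13] -/
theorem constantCoeff_oddSharp_eq_zero {Ls Lf : IwasawaAlgebra 2} (hSP : IsSprungPairOdd f 2 0 Ls Lf)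
    (hf : IsNewform0 f) (hQ : coeffField f = ⊥) (h2N : ¬ 2 ∣ N) (hap : cuspCoeff f 2 = ((0 : ℤ) : ℂ)) :
    PowerSeries.constantCoeff Ls = 0 := by
  have h := algebraMap_eval_zero_eq_of_isCongrModOmega (hSP.congr 1)
  rw [sharpPoly_one, flatPoly_one, map_one, map_zero, one_mul, zero_mul, add_zero,
    eval_zero_mazurTateElementOdd_two_one_eq_zero f hf hQ h2N hap, map_zero] at h
  simp only [Polynomial.eval_neg, Polynomial.eval_one, Int.cast_neg, Int.cast_one, neg_one_mul,
    zero_eq_neg] at h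
  exact PadicInt.coe_eq_zero.mp h

/-- **`a₂ = 0 ⇒ X ∣ L♯₋`** (AN-6, g2). [cite: Sprung2017, Cor. 4.4 (shape)] -/
theorem X_dvd_oddSharp {Ls Lf : IwasawaAlgebra 2} (hSP : IsSprungPairOdd f 2 0 Ls Lf)
    (hf : IsNewform0 f) (hQ : coeffField f = ⊥) (h2N : ¬ 2 ∣ N) (hap : cuspCoeff f 2 = ((0 : ℤ) : ℂ)) :
    (PowerSeries.X : IwasawaAlgebra 2) ∣ Ls :=
  PowerSeries.X_dvd_iff.mpr (constantCoeff_oddSharp_eq_zero f hSP hf hQ h2N hap)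

/-- **`L♭₋(0) = −2[1/4]⁻_f` in `ℚ₂` for EVERY odd pair (any weights `ap`)**: the level-0 clause
`θ⁻₀ ≡ −(u₀L♯₋ + v₀L♭₋) = −L♭₋ (mod ω₀ = T)` at `T = 0` and `θ⁻₀ = 2[1/4]⁻`. (`2[1/4]⁻ = [1/4]⁻ − [3/4]⁻`
is the `χ₋₄`-twisted symbol sum: the `E^{(−1)}`-value.) [cite: Sprung2017, Cor. 4.4 (shape)]
[cite: MazurTateTeitelbaum1986Invent, §I.8 (8.6), §I.13] -/
theorem coe_constantCoeff_oddFlat_eq {ap : ℤ} {Ls Lf : IwasawaAlgebra 2}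
    (hSP : IsSprungPairOdd f 2 ap Ls Lf) :
    ((PowerSeries.constantCoeff Lf : ℤ_[2]) : ℚ_[2]) = -2 * ((ratMinusSymbol f (1 / 4) : ℚ) : ℚ_[2]) := by
  have h := algebraMap_eval_zero_eq_of_isCongrModOmega (hSP.congr 0)
  rw [sharpPoly_zero, flatPoly_zero, map_zero, map_one, zero_mul, one_mul, zero_add,
    mazurTateElementOdd_two_zero, Polynomial.eval_C, eq_ratCast] at h
  simp only [Polynomial.eval_neg, Polynomial.eval_one, Int.cast_neg, Int.cast_one, neg_one_mul] at h
  push_cast at h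
  linear_combination h

omit [NeZero N] in
/-- The odd Sprung congruence as an IDENTITY in `Λ` (twin of `BlindFlat.exists_coe_add_eq_omega_mul`):
if `θ⁻_n` has the integral lift `Θ`, then `Θ + u_n L♯₋ + v_n L♭₋ = ω_n · R` for some `R ∈ ℤ₂⟦T⟧`.
[cite: Sprung2017, Cor. 4.4 (shape)] -/
theorem exists_coe_add_eq_omega_mul_odd {ap : ℤ} {Ls Lf : IwasawaAlgebra 2}
    (hSP : IsSprungPairOdd f 2 ap Ls Lf) {n : ℕ} {Θ : Polynomial ℤ_[2]}
    (hΘ : Θ.map (algebraMap ℤ_[2] ℚ_[2]) = (mazurTateElementOdd f 2 n).map (algebraMap ℚ ℚ_[2])) :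
    ∃ R : PowerSeries ℤ_[2], (Θ : PowerSeries ℤ_[2]) + toIwasawa 2 (sharpPoly ap 2 n) * Ls +
        toIwasawa 2 (flatPoly ap 2 n) * Lf =
      (((cyclotomicOmega 2 n).map (Int.castRingHom ℤ_[2]) : Polynomial ℤ_[2]) :
        PowerSeries ℤ_[2]) * R := by
  obtain ⟨r, hr⟩ := (hSP.congr n).exists_mul_sub_eq (BlindFlat.isCongrModOmega_neg_coe hΘ)
  have hneg : (((-1 : Polynomial ℤ).map (Int.castRingHom ℤ_[2]) : Polynomial ℤ_[2]) :
      PowerSeries ℤ_[2]) = -1 := by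
    rw [Polynomial.map_neg, Polynomial.map_one, Polynomial.coe_neg, Polynomial.coe_one]
  rw [hneg] at hr
  exact ⟨-r, by linear_combination -hr⟩

/-- **`L♯₋(−2) = −θ⁻₁(−2) = −2([1/8]⁻_f − [5/8]⁻_f)` in `ℚ₂` for EVERY odd pair** of a form with real
coefficients and `4 ∤ N` (so that `θ⁻₁` is `2`-integral, `exists_map_eq_map_mazurTateElementOdd_two`):
the level-1 clause `Θ + u₁L♯₋ + v₁L♭₋ = ω₁R` valued at `T = −2` (`u₁(−2) = 1`, `v₁(−2) = 0`,
`ω₁(−2) = 0`). The odd twin of `BlindLever.coe_evalAt_sharp_neg_two_eq`.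
[cite: Sprung2017, Cor. 4.4 (shape)] [cite: MazurTateTeitelbaum1986Invent, §I.13] -/
theorem coe_evalAt_oddSharp_neg_two_eq (hreal : ∀ n, (cuspCoeff f n).im = 0) (h4 : ¬ 4 ∣ N)
    {ap : ℤ} {Ls Lf : IwasawaAlgebra 2} (hSP : IsSprungPairOdd f 2 ap Ls Lf) :
    ((BlindLever.evalAt (-2 : ℤ_[2]) Ls : ℤ_[2]) : ℚ_[2]) =
      -2 * ((ratMinusSymbol f ((1 : ℚ) / 8) - ratMinusSymbol f ((5 : ℚ) / 8) : ℚ) : ℚ_[2]) := by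
  have ht := BlindLever.norm_neg_two_lt_one
  obtain ⟨Θ, hΘ⟩ := exists_map_eq_map_mazurTateElementOdd_two hreal h4 1
  obtain ⟨R, hR⟩ := exists_coe_add_eq_omega_mul_odd f hSP hΘ
  obtain ⟨hu, -, hv, -⟩ := BlindFlat.evalAt_derivAt_sharp_flat ap (le_refl 1)
  have hΩ := BlindFlat.evalAt_omega_eq_zero (le_refl 1)
  have h := congrArg (BlindLever.evalAt (-2 : ℤ_[2])) hR
  rw [BlindLever.evalAt_add ht, BlindLever.evalAt_add ht, BlindLever.evalAt_mul ht,
    BlindLever.evalAt_mul ht, BlindLever.evalAt_mul ht, hu, hv, hΩ, zero_mul, zero_mul, add_zero,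
    BlindFlat.cSeq_one, Int.cast_one, one_mul] at h
  have hΘv := BlindFlat.coe_evalAt_eq_of_map_eq hΘ
  rw [eval_neg_two_mazurTateElementOdd_two_one] at hΘv
  have hLs : BlindLever.evalAt (-2 : ℤ_[2]) Ls =
      -BlindLever.evalAt (-2 : ℤ_[2]) (Θ : PowerSeries ℤ_[2]) := by
    linear_combination h
  rw [hLs, PadicInt.coe_neg, hΘv]
  push_cast
  ring

end Values

end Summit.BirchSwinnertonDyer.Rank1Residual.F1Sign2

end
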